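import Literature.Analysis.FluidPDE.LeiZhang2011RegularityCase1
import Literature.Analysis.FluidPDE.LeiZhang2011RegularityCase2
import Literature.Analysis.FluidPDE.SwirlMaximumPrinciple
import Literature.Analysis.FluidPDE.KNSSTypeIIHolds
import HarnessLib

/-!
# Lei–Zhang 2011, Theorem 1.4 in the classical frame, conditional on the swirl step

Analysis/FluidPDE **proofs file** (theorems only: no definitions, no named facts, no `sorry`) on
the discharge path of the named fact
`Literature.Analysis.FluidPDE.LeiZhang2011_regularity_bmoStream` (Z. Lei, Q. S. Zhang,
J. Funct. Anal. 261 (2011) = arXiv:1011.5066, **Theorem 1.4**; proof §4, pp. 12–13).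

`LeiZhang2011_regularity_classical_of_swirlStep`: a classical solution of Navier–Stokes on
`(0, T) × ℝ³`, bounded on earlier slabs, with axisymmetric slices, `|r v^θ| ≤ C₁` and a stream
function in `L^∞((0, T); BMO)`, is bounded up to `T` — **provided the swirl step holds**: every
continuous bounded weak ancient axisymmetric solution with bounded `Γ` and distributional
`L^∞_t BMO_x` stream function is swirl free. In the paper the swirl step is Theorem 1.1
(Hölder continuity of `Γ` at the axis, hence `Γ = 0` there and, by scaling and the ancient
character, everywhere: §§2–3); it is the one ingredient of the printed proof not formalized in
the tree, so it is kept as an explicit hypothesis (not a named fact). Everything else of the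
printed proof of Theorem 1.4 is assembled here: the near-maximum selection and normalisations of
`KNSS2009_regularity_bound_C_over_r_one`, the rotation of `x_k` onto the meridian half-plane, and
the dichotomy `r_k Q_k` bounded (`case1_false`) / `r_k Q_k → ∞` (`case2_false`).
Two corollaries put it in the shape of the printed statement: the datum form
`LeiZhang2011_regularity_classical_datum_of_swirlStep` (`|r v^θ(·, 0)| ≤ C` at the initial time
only, propagated by the proved maximum principle `abs_swirl_le_of_classical`, Remark 1.5) and the
continuation form `LeiZhang2011_hasSmoothExtensionPast_of_swirlStep` (a Leray–Hopf classical
solution with these properties has no first blow-up time: the proved continuation principle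
`hasSmoothExtensionPast_of_bounded_holds`, RRS 2016 Thm. 8.17).

## Mathlib / tree search

Reused: `exists_near_max` (`KNSSTypeIIZoomIn`), `exists_meridian_point_norm_eq`
(`LeiZhang2011ZoomOffAxis`), `cylRadius_nonneg`, `abs_swirl_le_of_classical`
(`SwirlMaximumPrinciple`), `hasSmoothExtensionPast_of_bounded_holds`, `exists_bound_Ico_of_Ioo`
(`KNSSTypeII`, `KNSSTypeIIHolds`), Mathlib `Filter.extraction_of_frequently_atTop`,
`Filter.not_frequently`, `Filter.tendsto_atTop`.

## References

* Z. Lei, Q. S. Zhang, J. Funct. Anal. 261 (2011) = arXiv:1011.5066: Thm. 1.4 and its proof §4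
  (pp. 12–13); Thm. 1.1. [LeiZhang2011]
* G. Koch, N. Nadirashvili, G. Seregin, V. Šverák, Acta Math. 203 (2009) = arXiv:0709.3599,
  §6. [KochNadirashviliSereginSverak2009]
* J. C. Robinson, J. L. Rodrigo, W. Sadowski, *The Three-Dimensional Navier–Stokes Equations*,
  CUP (2016), Thm. 8.17. [RobinsonRodrigoSadowski2016]
-/

noncomputable section

open MeasureTheory Set Function Filter Topology TopologicalSpace Metric
open scoped InnerProductSpace RealInnerProductSpace NNReal ENNReal

namespace Literature.Analysis.FluidPDE

open Literature.Analysis.FunctionSpaces SereginSverak2009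

/-- The cylindrical radius of a point of the meridian plane `{x₁ = 0}` with `x₀ ≥ 0` is `x₀`.
[folklore] -/
theorem cylRadius_eq_apply_zero {x : EuclideanSpace ℝ (Fin 3)} (h1 : x 1 = 0) (h0 : 0 ≤ x 0) :
    cylRadius x = x 0 := by
  unfold cylRadius
  rw [h1, zero_pow two_ne_zero, add_zero, Real.sqrt_sq h0]

/-- **Lei–Zhang 2011, Theorem 1.4 (classical frame), conditional on the swirl step.** Let
`(u, p)` be a classical solution of the unforced Navier–Stokes system (`ν = 1`) on
`(0, T) × ℝ³`, bounded on every `(0, T') × ℝ³`, `T' < T`, with axisymmetric slices,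
`|Γ| = |r u^θ| ≤ C₁` on `(0, T) × ℝ³`, and a stream function with `BMO` slices,
`sup_t ‖B(t)‖_BMO ≤ K` (`HasBMOStreamFunctionOn`). Assume the **swirl step** `hstep` (the content
of Theorem 1.1 of the paper as used in the proof of Theorem 1.4, Case 1: a continuous bounded weak
ancient axisymmetric solution with bounded `Γ` and distributional `L^∞_t BMO_x` stream function is
swirl free). Then `u` is bounded on `(0, T) × ℝ³`. Printed proof (arXiv:1011.5066 pp. 12–13):
by contradiction, near-maxima `(t_k, x_k)` with `Q_k = |v(t_k, x_k)| → ∞`, rescaling (1.6),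
and the dichotomy `r_k Q_k` bounded (Case 1: zoom on the axis, limit axisymmetric ancient,
swirl free by Theorem 1.1, zero by [KNSS] Thm. 5.2 and the `BMO⁻¹` bound — `case1_false`) or
`r_k Q_k → ∞` (Case 2: zoom at `x_k`, limit planar, constant by [KNSS] Thm. 5.1, zero by the
`BMO⁻¹` bound — `case2_false`); either way `|u(0, ·)| = 1` somewhere, a contradiction. The
near-maximum selection and the normalisations `t_k Q_k² ≥ 2`, `t_k Q_k² → ∞` are those of
`KNSS2009_regularity_bound_C_over_r_one`; `x_k` is rotated onto the meridian half-plane by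
axisymmetry (`exists_meridian_point_norm_eq`). [cite: LeiZhang2011, Thm. 1.4 and its proof §4 (arXiv pp. 12–13)] -/
theorem LeiZhang2011_regularity_classical_of_swirlStep
    (hstep : ∀ (v : ℝ → EuclideanSpace ℝ (Fin 3) → EuclideanSpace ℝ (Fin 3)) (C : ℝ),
      IsBoundedWeakNSSolutionOn (Iio 0) isOpen_Iio 1 v → Continuous (uncurry v) →
      (∀ t < 0, IsAxisymmetric (v t)) → (∀ t < 0, ∀ x, |swirl (v t) x| ≤ C) →
      (∀ t < 0, ∃ Bt : EuclideanSpace ℝ (Fin 3) → EuclideanSpace ℝ (Fin 3),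
        LocallyIntegrable Bt volume ∧ eBMOSeminormVec Bt < ∞ ∧
        ∀ (φ : EuclideanSpace ℝ (Fin 3) → ℝ) (e : EuclideanSpace ℝ (Fin 3)),
          ContDiff ℝ 1 φ → HasCompactSupport φ →
            ∫ x, φ x * ⟪v t x, e⟫ = ∫ x, ⟪cross (Bt x) (gradient φ x), e⟫) →
      ∀ t < 0, HasNoSwirl (v t))
    {T : ℝ} {u : ℝ → EuclideanSpace ℝ (Fin 3) → EuclideanSpace ℝ (Fin 3)}
    {p : ℝ → EuclideanSpace ℝ (Fin 3) → ℝ} (hT : 0 < T)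
    (h : IsClassicalNSSolutionOn (Ioo 0 T) 1 0 u p)
    (hbdd : ∀ T' < T, ∃ M : ℝ, ∀ t ∈ Ioo 0 T', ∀ x, ‖u t x‖ ≤ M)
    (haxi : ∀ t ∈ Ioo 0 T, IsAxisymmetric (u t))
    (hΓ : ∃ C₁ : ℝ, ∀ t ∈ Ioo 0 T, ∀ x, |swirl (u t) x| ≤ C₁)
    (hB : ∃ (B : ℝ → EuclideanSpace ℝ (Fin 3) → EuclideanSpace ℝ (Fin 3)) (K : ℝ≥0),
      HasBMOStreamFunctionOn (Ioo 0 T) u B K) :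
    ∃ M : ℝ, ∀ t ∈ Ioo 0 T, ∀ x, ‖u t x‖ ≤ M := by
  obtain ⟨C₁, hC₁⟩ := hΓ
  obtain ⟨Bs, Kb, hBs⟩ := hB
  by_contra hunb
  -- a bound on `(0, 3T/4) × ℝ³`
  obtain ⟨Bbar, hBbar⟩ := hbdd (3 * T / 4) (by linarith)
  -- the near-maxima, rotated onto the meridian half-plane
  have hsel := fun n : ℕ => exists_near_max hbdd hunb (((n : ℝ) + 3) * (1 + 1 / T) + |Bbar|)
  choose tn htn xn' hR' hmax' using hsel
  have hmer := fun n : ℕ => exists_meridian_point_norm_eq (haxi _ (htn n)) (xn' n)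
  choose xn hx1 hx0 _hx2 hnorm using hmer
  have hR : ∀ n : ℕ, ((n : ℝ) + 3) * (1 + 1 / T) + |Bbar| < ‖u (tn n) (xn n)‖ := fun n => by
    rw [hnorm]; exact hR' n
  have hmax : ∀ n, ∀ s ∈ Ioc 0 (tn n), ∀ y, ‖u s y‖ ≤ 2 * ‖u (tn n) (xn n)‖ := fun n => by
    rw [hnorm]; exact hmax' n
  have hcyl : ∀ n, cylRadius (xn n) = xn n 0 := fun n =>
    cylRadius_eq_apply_zero (hx1 n) (by rw [hx0]; exact cylRadius_nonneg _)
  set M : ℕ → ℝ := fun n => ‖u (tn n) (xn n)‖ with hMdef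
  have hRpos : ∀ n : ℕ, (3 : ℝ) ≤ ((n : ℝ) + 3) * (1 + 1 / T) := fun n => by
    have h1 : (1 : ℝ) ≤ 1 + 1 / T := by simp [hT.le]
    nlinarith [n.cast_nonneg (α := ℝ)]
  have hM1 : ∀ n : ℕ, ((n : ℝ) + 3) * (1 + 1 / T) ≤ M n := fun n => by
    have := hR n; linarith [abs_nonneg Bbar]
  have hMone : ∀ n, 1 ≤ M n := fun n => by linarith [hRpos n, hM1 n]
  have hMpos : ∀ n, 0 < M n := fun n => by linarith [hMone n]
  have htn34 : ∀ n, 3 * T / 4 ≤ tn n := fun n => by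
    by_contra hlt
    push Not at hlt
    have h1 : M n ≤ Bbar := hBbar (tn n) ⟨(htn n).1, hlt⟩ (xn n)
    have h2 : |Bbar| < M n := by have := hR n; linarith [hRpos n]
    linarith [le_abs_self Bbar]
  -- `t_n M_n² ≥ (n + 3)(3/4)`
  have hAle : ∀ n : ℕ, ((n : ℝ) + 3) * (3 / 4) ≤ tn n * M n ^ 2 := fun n => by
    have h1 : ((n : ℝ) + 3) * (1 + 1 / T) * 1 ≤ M n * M n :=
      mul_le_mul (hM1 n) (hMone n) zero_le_one (hMpos n).le
    have h2 : T * (1 + 1 / T) = T + 1 := by field_simp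
    have h3 : 3 * T / 4 * (((n : ℝ) + 3) * (1 + 1 / T)) ≤ tn n * M n ^ 2 := by
      rw [sq]
      exact mul_le_mul (htn34 n) (by simpa using h1) (by nlinarith [hRpos n]) (htn n).1.le
    have h4 : 3 * T / 4 * (((n : ℝ) + 3) * (1 + 1 / T)) = ((n : ℝ) + 3) * (3 / 4) * (T + 1) := by
      rw [← h2]; ring
    nlinarith [n.cast_nonneg (α := ℝ)]
  have hA2 : ∀ n, 2 ≤ tn n * M n ^ 2 := fun n => by nlinarith [hAle n, n.cast_nonneg (α := ℝ)]
  have hAtop : Tendsto (fun n => tn n * M n ^ 2) atTop atTop := by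
    refine tendsto_atTop_mono hAle ?_
    exact (tendsto_natCast_atTop_atTop.atTop_add tendsto_const_nhds).atTop_mul_const (by norm_num)
  -- the dichotomy on `r_n M_n`
  by_cases hcase : ∃ D : ℝ, ∃ᶠ n in atTop, M n * xn n 0 ≤ D
  · -- Case 1: `r_n M_n` bounded along a subsequence
    obtain ⟨D, hD⟩ := hcase
    obtain ⟨ρ, hρ, hρD⟩ := extraction_of_frequently_atTop hD
    exact case1_false h haxi hC₁ hBs hstep (tn := tn ∘ ρ) (xn := xn ∘ ρ) (fun n => htn (ρ n))
      (fun n => hMpos (ρ n)) (fun n => hmax (ρ n)) (fun n => hA2 (ρ n))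
      (hAtop.comp hρ.tendsto_atTop) (D := D) fun n => by
        show cylRadius (xn (ρ n)) * M (ρ n) ≤ D
        rw [hcyl, mul_comm]; exact hρD n
  · -- Case 2: `r_n M_n → ∞`
    simp only [not_exists, not_frequently, not_le] at hcase
    have hRt : Tendsto (fun n => M n * xn n 0) atTop atTop :=
      tendsto_atTop.2 fun D => (hcase D).mono fun n hn => hn.le
    exact case2_false h haxi hC₁ hBs htn hx1 hMpos hmax hA2 hAtop hRt

/-- **Lei–Zhang 2011, Theorem 1.4 (classical frame, datum form), conditional on the swirl
step.** As `LeiZhang2011_regularity_classical_of_swirlStep`, for a classical solution on the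
half-open slab `[0, T) × ℝ³` bounded on every closed sub-slab `[0, T'] × ℝ³`, `T' < T`, with the
bound on `Γ = r v^θ` assumed **at the initial time only** ("Note condition `|r v^θ(x, 0)| < C`
is only on the initial value", Remark 1.5): the maximum principle for the swirl
(`abs_swirl_le_of_classical`, "`r v^θ` … satisfies the maximum principle", p. 4) propagates it
to `(0, T)`. [cite: LeiZhang2011, Thm. 1.4, Rem. 1.5 and proof §4 (arXiv pp. 4, 12–13)] -/
theorem LeiZhang2011_regularity_classical_datum_of_swirlStep
    (hstep : ∀ (v : ℝ → EuclideanSpace ℝ (Fin 3) → EuclideanSpace ℝ (Fin 3)) (C : ℝ),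
      IsBoundedWeakNSSolutionOn (Iio 0) isOpen_Iio 1 v → Continuous (uncurry v) →
      (∀ t < 0, IsAxisymmetric (v t)) → (∀ t < 0, ∀ x, |swirl (v t) x| ≤ C) →
      (∀ t < 0, ∃ Bt : EuclideanSpace ℝ (Fin 3) → EuclideanSpace ℝ (Fin 3),
        LocallyIntegrable Bt volume ∧ eBMOSeminormVec Bt < ∞ ∧
        ∀ (φ : EuclideanSpace ℝ (Fin 3) → ℝ) (e : EuclideanSpace ℝ (Fin 3)),
          ContDiff ℝ 1 φ → HasCompactSupport φ →
            ∫ x, φ x * ⟪v t x, e⟫ = ∫ x, ⟪cross (Bt x) (gradient φ x), e⟫) →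
      ∀ t < 0, HasNoSwirl (v t))
    {T : ℝ} {u : ℝ → EuclideanSpace ℝ (Fin 3) → EuclideanSpace ℝ (Fin 3)}
    {p : ℝ → EuclideanSpace ℝ (Fin 3) → ℝ} (hT : 0 < T)
    (h : IsClassicalNSSolutionOn (Ico 0 T) 1 0 u p)
    (hbdd : ∀ T' < T, ∃ M : ℝ, ∀ t ∈ Icc 0 T', ∀ x, ‖u t x‖ ≤ M)
    (haxi : ∀ t ∈ Ico 0 T, IsAxisymmetric (u t))
    (hΓ₀ : ∃ C : ℝ, ∀ x, |swirl (u 0) x| ≤ C)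
    (hB : ∃ (B : ℝ → EuclideanSpace ℝ (Fin 3) → EuclideanSpace ℝ (Fin 3)) (K : ℝ≥0),
      HasBMOStreamFunctionOn (Ioo 0 T) u B K) :
    ∃ M : ℝ, ∀ t ∈ Ioo 0 T, ∀ x, ‖u t x‖ ≤ M := by
  obtain ⟨C, hC⟩ := hΓ₀
  -- the maximum principle for the swirl on every closed sub-slab `[0, T']`
  have hΓ : ∀ t ∈ Ioo 0 T, ∀ x, |swirl (u t) x| ≤ C := by
    intro t ht x
    obtain ⟨T', htT', hT'T⟩ := exists_between ht.2
    have hT' : 0 < T' := ht.1.trans htT'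
    obtain ⟨V, hV⟩ := hbdd T' hT'T
    have hcl : IsClassicalNSSolutionOn (Icc 0 T') 1 0 u p :=
      h.mono (Icc_subset_Ico_right hT'T) (uniqueDiffOn_Icc hT')
    exact abs_swirl_le_of_classical one_pos hT' hcl (fun s hs => haxi s ⟨hs.1, hs.2.trans_lt hT'T⟩)
      hV hC t ⟨ht.1.le, htT'.le⟩ x
  exact LeiZhang2011_regularity_classical_of_swirlStep hstep hT
    (h.mono Ioo_subset_Ico_self (uniqueDiffOn_Ioo 0 T))
    (fun T' hT' => (hbdd T' hT').imp fun M hM t ht x => hM t ⟨ht.1.le, ht.2.le⟩ x)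
    (fun t ht => haxi t ⟨ht.1.le, ht.2⟩) ⟨C, hΓ⟩ hB

/-- **Lei–Zhang 2011, Theorem 1.4 (classical frame, continuation form), conditional on the swirl
step: no first blow-up time.** A classical solution of Navier–Stokes (`ν = 1`) on `[0, T) × ℝ³`
which is Leray–Hopf from `u 0`, bounded on every `[0, T'] × ℝ³`, `T' < T`, axisymmetric, with
`|r v^θ(·, 0)| ≤ C` and a stream function in `L^∞((0, T); BMO)`, extends as a classical solution
past `T` — provided the swirl step holds. (`LeiZhang2011_regularity_classical_datum_of_swirlStep`
bounds `u` on `(0, T) × ℝ³`; the proved continuation principle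
`hasSmoothExtensionPast_of_bounded_holds` — Robinson–Rodrigo–Sadowski 2016, Thm. 8.17 — continues
the bounded Leray–Hopf solution; this is the form "`t = 0` is a blow up time of `v` … This
contradiction proves that singularity can not occur" of the printed proof, p. 12.) [cite: LeiZhang2011, Thm. 1.4 and proof §4 (arXiv pp. 4, 12–13)] -/
theorem LeiZhang2011_hasSmoothExtensionPast_of_swirlStep
    (hstep : ∀ (v : ℝ → EuclideanSpace ℝ (Fin 3) → EuclideanSpace ℝ (Fin 3)) (C : ℝ),
      IsBoundedWeakNSSolutionOn (Iio 0) isOpen_Iio 1 v → Continuous (uncurry v) →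
      (∀ t < 0, IsAxisymmetric (v t)) → (∀ t < 0, ∀ x, |swirl (v t) x| ≤ C) →
      (∀ t < 0, ∃ Bt : EuclideanSpace ℝ (Fin 3) → EuclideanSpace ℝ (Fin 3),
        LocallyIntegrable Bt volume ∧ eBMOSeminormVec Bt < ∞ ∧
        ∀ (φ : EuclideanSpace ℝ (Fin 3) → ℝ) (e : EuclideanSpace ℝ (Fin 3)),
          ContDiff ℝ 1 φ → HasCompactSupport φ →
            ∫ x, φ x * ⟪v t x, e⟫ = ∫ x, ⟪cross (Bt x) (gradient φ x), e⟫) →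
      ∀ t < 0, HasNoSwirl (v t))
    {T : ℝ} {u : ℝ → EuclideanSpace ℝ (Fin 3) → EuclideanSpace ℝ (Fin 3)}
    {p : ℝ → EuclideanSpace ℝ (Fin 3) → ℝ} (hT : 0 < T)
    (h : IsClassicalNSSolutionOn (Ico 0 T) 1 0 u p) (hLH : IsLerayHopfOn T 1 0 (u 0) u)
    (hbdd : ∀ T' < T, ∃ M : ℝ, ∀ t ∈ Icc 0 T', ∀ x, ‖u t x‖ ≤ M)
    (haxi : ∀ t ∈ Ico 0 T, IsAxisymmetric (u t))
    (hΓ₀ : ∃ C : ℝ, ∀ x, |swirl (u 0) x| ≤ C)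
    (hB : ∃ (B : ℝ → EuclideanSpace ℝ (Fin 3) → EuclideanSpace ℝ (Fin 3)) (K : ℝ≥0),
      HasBMOStreamFunctionOn (Ioo 0 T) u B K) :
    HasSmoothExtensionPast 1 0 u T :=
  hasSmoothExtensionPast_of_bounded_holds one_pos hT h hLH (exists_bound_Ico_of_Ioo hT hbdd
    (LeiZhang2011_regularity_classical_datum_of_swirlStep hstep hT h hbdd haxi hΓ₀ hB))

end Literature.Analysis.FluidPDE
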